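import Literature.Geometry.Kaehler.HolomorphicChainBlowUp
import Literature.Geometry.GeometricMeasureTheory.RectifiableDataRestrict
import Literature.Geometry.GeometricMeasureTheory.MassFormula
import HarnessLib

/-!
# Harvey's mass identity for blow-ups: `𝐌_{B(0,1)}((1/r)_* T) = r^{-2p} 𝐌_{B(b,r)}(T)`

With the mass formula `𝐌([W, θ, ξ]) = ∫_W |θ| d𝓗^m` of `MassFormula.lean` (Federer 4.1.28 (5)) and
the transported admissible data of `HolomorphicChainBlowUp.lean`, the masses of the blow-ups
`D_r = (1/r)_*(τ_{-b})_*[T]` of a holomorphic `p`-chain with admissible data are computed exactly: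

* `HolomorphicChain.mass_toCurrentIn_ball_eq` — `𝐌([T]|_{B(b,r)}) = ∫_{reg|T| ∩ B(b,r)} |θ_T| d𝓗^{2p}`
  (`[T]|_{B(b,r)} = T.toCurrentIn ⟨B(b,r), _⟩`, data cut down to the ball,
  `RectifiableDataRestrict.lean`);
* `HolomorphicChain.mass_blowUp_eq` — `𝐌(D_r) = r^{-2p} ∫_{reg|T| ∩ B(b,r)} |θ_T| d𝓗^{2p}`
  (change of variables `A_#(𝓗^{2p} ⌞ A⁻¹S) = r^{-2p} 𝓗^{2p} ⌞ S`, `DilationInvariance.lean`);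
* `HolomorphicChain.mass_blowUp_eq_mul_mass_toCurrentIn` — hence Harvey's
  **`𝐌_{B(0,1)}((1/r)_*(T)) = (1/r^{2p}) 𝐌_{B(b,r)}(T)`** [Harvey1977, §1.10] with equality (the
  inequality `≤` is `HolomorphicChain.mass_blowUp_le`); in particular the family `(D_r)_{r ≤ r₀}`
  has bounded mass iff the `|θ_T|`-weighted density ratios `r^{-2p} ∫_{B(b,r)} |θ_T| d𝓗^{2p} ⌞ reg|T|`
  are bounded — the hypothesis under which weak subsequential tangent cones exist
  (`Current.exists_subseq_tendsto_of_mass_le`).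

No definitions, no named facts (the admissibility of the data is the content of
`Harvey1977_isRectifiableData_toCurrent`; primed versions take it as a hypothesis).

## References

* R. Harvey, *Holomorphic chains and their boundaries*, PSPUM XXX.1 (1977), §1.10 [Harvey1977].
* H. Federer, *Geometric Measure Theory*, Springer 1969, 4.1.28 (5), 4.3.16 [Federer1969].
-/

open scoped Manifold ContDiff Topology ENNReal Pointwise
open Set Filter MeasureTheory

namespace Literature.Geometry.Kaehler

open Literature.Geometry.GeometricMeasureTheory

-- Nested operator-norm instances on `Covector V m`, as in `Currents.lean`.
set_option maxSynthPendingDepth 2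

universe u

variable {V : Type*} [NormedAddCommGroup V] [InnerProductSpace ℂ V] [FiniteDimensional ℂ V]
  [MeasurableSpace V] [BorelSpace V] {Ω : TopologicalSpace.Opens V} {p : ℕ}

/-- **`𝐌([T]|_{B(b,r)}) = ∫_{reg|T| ∩ B(b,r)} |θ_T| d𝓗^{2p}`** for a chain with admissible data and
`B(b,r) ⊆ Ω`: the current of `T` read on the ball is the current of integration over the cut-down
carrier, whose mass the mass formula computes. [cite: Federer1969, 4.1.28 (5)] -/
theorem HolomorphicChain.mass_toCurrentIn_ball_eq (T : HolomorphicChain 𝓘(ℂ, V) Ω p)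
    (hT : letI : InnerProductSpace ℝ V := InnerProductSpace.complexToReal
      IsRectifiableData Ω (2 * p) T.carrier T.density T.orientationFrame)
    {b : V} {r : ℝ} (hball : Metric.ball b r ⊆ (Ω : Set V)) :
    (T.toCurrentIn (⟨Metric.ball b r, Metric.isOpen_ball⟩ : TopologicalSpace.Opens V)).mass =
      ∫⁻ x in T.carrier ∩ Metric.ball b r, ‖(T.density x : ℝ)‖ₑ ∂(μHE[2 * p] : Measure V) := by
  letI : InnerProductSpace ℝ V := InnerProductSpace.complexToReal
  have hle : (⟨Metric.ball b r, Metric.isOpen_ball⟩ : TopologicalSpace.Opens V) ≤ Ω := hball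
  rw [HolomorphicChain.toCurrentIn, ← currentOfIntegration_inter_eq_of_le hT.1 hle hT.2.2.2.1,
    (hT.inter_of_le hle).mass_eq]
  rfl

/-- **`𝐌(D_r) = r^{-2p} ∫_{reg|T| ∩ B(b,r)} |θ_T| d𝓗^{2p}`**: the mass of the blow-up
`D_r = (1/r)_*(τ_{-b})_*[T]` on `B(0,1)` (admissible data, `0 < r`, `B(b,r) ⊆ Ω`), by the mass
formula for the transported data and the change of variables `y = (x - b)/r`.
[cite: Harvey1977, §1.10] -/
theorem HolomorphicChain.mass_blowUp_eq (T : HolomorphicChain 𝓘(ℂ, V) Ω p)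
    (hT : letI : InnerProductSpace ℝ V := InnerProductSpace.complexToReal
      IsRectifiableData Ω (2 * p) T.carrier T.density T.orientationFrame)
    {b : V} {r : ℝ} (hr : 0 < r) (hball : Metric.ball b r ⊆ (Ω : Set V)) :
    (T.blowUp b r).mass = ENNReal.ofReal (r⁻¹ ^ (2 * p)) *
      ∫⁻ x in T.carrier ∩ Metric.ball b r, ‖(T.density x : ℝ)‖ₑ ∂(μHE[2 * p] : Measure V) := by
  letI : InnerProductSpace ℝ V := InnerProductSpace.complexToReal
  rw [HolomorphicChain.blowUp, (T.isRectifiableData_blowUp hT hr hball).mass_eq]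
  -- the carrier of `D_r` is `A⁻¹(reg|T| ∩ B(b,r))`, `A y = b + r • y`
  have hmeas : Measurable (fun y : V => b + r • y) := (measurable_const_smul r).const_add b
  have hset : (fun y : V => b + r • y) ⁻¹' T.carrier ∩ Metric.ball (0 : V) 1 =
      (fun y : V => b + r • y) ⁻¹' (T.carrier ∩ Metric.ball b r) := by
    ext y
    simp only [mem_inter_iff, mem_preimage, Metric.mem_ball, dist_eq_norm, sub_zero,
      add_sub_cancel_left, norm_smul, Real.norm_of_nonneg hr.le]
    constructor
    · rintro ⟨h1, h2⟩
      exact ⟨h1, by nlinarith⟩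
    · rintro ⟨h1, h2⟩
      exact ⟨h1, by nlinarith⟩
  rw [hset]
  -- change of variables under the measurable equivalence `A`
  let eA : V ≃ᵐ V :=
    ((Homeomorph.smulOfNeZero r hr.ne').trans (Homeomorph.addLeft b)).toMeasurableEquiv
  have heA : ⇑eA = fun y : V => b + r • y := rfl
  have h1 : ∫⁻ y in (fun y : V => b + r • y) ⁻¹' (T.carrier ∩ Metric.ball b r),
      ‖((T.density (b + r • y) : ℤ) : ℝ)‖ₑ ∂(μHE[2 * p] : Measure V) =
      ∫⁻ x, ‖((T.density x : ℤ) : ℝ)‖ₑ ∂(Measure.map eA ((μHE[2 * p] : Measure V).restrict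
        ((fun y : V => b + r • y) ⁻¹' (T.carrier ∩ Metric.ball b r)))) := by
    rw [lintegral_map_equiv]
    rfl
  rw [h1, heA, map_add_smul_restrict_preimage b hr, lintegral_smul_measure, smul_eq_mul]

/-- **Harvey's mass identity `𝐌_{B(0,1)}((1/r)_*(T)) = (1/r^{2p}) 𝐌_{B(b,r)}(T)`** for a holomorphic
`p`-chain with admissible data (`0 < r`, `B(b,r) ⊆ Ω`). [cite: Harvey1977, §1.10] -/
theorem HolomorphicChain.mass_blowUp_eq_mul_mass_toCurrentIn (T : HolomorphicChain 𝓘(ℂ, V) Ω p)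
    (hT : letI : InnerProductSpace ℝ V := InnerProductSpace.complexToReal
      IsRectifiableData Ω (2 * p) T.carrier T.density T.orientationFrame)
    {b : V} {r : ℝ} (hr : 0 < r) (hball : Metric.ball b r ⊆ (Ω : Set V)) :
    (T.blowUp b r).mass = ENNReal.ofReal (r⁻¹ ^ (2 * p)) *
      (T.toCurrentIn (⟨Metric.ball b r, Metric.isOpen_ball⟩ : TopologicalSpace.Opens V)).mass := by
  rw [T.mass_blowUp_eq hT hr hball, T.mass_toCurrentIn_ball_eq hT hball]

/-- Harvey's mass identity under the named fact `Harvey1977_isRectifiableData_toCurrent`.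
[cite: Harvey1977, §1.10] -/
theorem HolomorphicChain.mass_blowUp_eq_mul_mass_toCurrentIn'
    (h : Harvey1977_isRectifiableData_toCurrent.{u}) {V : Type u} [NormedAddCommGroup V]
    [InnerProductSpace ℂ V] [FiniteDimensional ℂ V] [MeasurableSpace V] [BorelSpace V]
    {Ω : TopologicalSpace.Opens V} {p : ℕ} (T : HolomorphicChain 𝓘(ℂ, V) Ω p) {b : V} {r : ℝ}
    (hr : 0 < r) (hball : Metric.ball b r ⊆ (Ω : Set V)) :
    (T.blowUp b r).mass = ENNReal.ofReal (r⁻¹ ^ (2 * p)) *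
      (T.toCurrentIn (⟨Metric.ball b r, Metric.isOpen_ball⟩ : TopologicalSpace.Opens V)).mass :=
  T.mass_blowUp_eq_mul_mass_toCurrentIn (h V Ω p T) hr hball

end Literature.Geometry.Kaehler
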